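import Summits.QuantumFields.YangMills.Theorems.BalabanUVNodesN16OfEdgesAllTorusAtRecord13CoPH
import Summits.QuantumFields.YangMills.Theorems.BalabanUVNodesN16AtReadingOfRecord13CoPH

/-!
# Route «BalabanUVNodes», cluster K4 «SpineRates» — node N16 = NE3: THE LEAF-FORM KNITS AT THE STAGE-13 `CoPH` RATE HOMES AND AT dag-n22-e's NAMED READING OF RECORD IN THE
# LIVE, AT-KEYED LEAF CURRENCY (`LeafSlotAT` ∕ `LeafSlotHolderAT β` ∕ `LeafSlotHolderMSAT β` — node N05's conjuncts at the PINNED all-torus proper sub-index) — the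
# one-token repair `LeafSlot ↦ LeafSlotAT` of this seat's univ-keyed leaf-form faces (modules 19ᴴ `…N16AtRRec13CoPH` l.132∕221∕256∕298∕312, 20ᴴ, 22ᴴ, 23ᴴ `…N16AtReadingOfRecord13CoPH`
# l.126∕133∕163), which dag-n27-c's K3⁷ composers call (`…N27AtAdmReadingOfRecord13CoPHKnitN15` :121∕:169∕:242∕:307, `…N27AtReadingOfRecord13CoPH`, K3⁷ Homes :176)

Cell `pub-ymgap`, seat `pub-ymgap-dag-n16-e` (R134 acceleration seat (a), strategy s2 = BY-NAME KNIT at the record; HUMAN RULING D-0062; chair R424 venue), generation 13,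
module 39ᴴ (THEOREMS ONLY, 0 `def`, 0 `sorry`, standard axioms).  `--kind proof --supports stmt-QuantumFields-20544 --as helper` (K3⁷ `SpineGivenEndpointR13SepCoPH`).
`bears_on: R4∕N16 · out-edges N16 → N21, N16 → N27 (composite)`.  Over modules 19ᴴ ∕ 20ᴴ ∕ 22ᴴ ∕ 23ᴴ (the constant-layer iffs `s_N16_rRec₁₃CoPH_iff_of_constLayer`,
`s_N16_rRec₁₃CoPHOn_iff_of_constLayer` ∕ `_iff_ofRecord`, `s_N16Holder_rRec₁₃CoPH(On)_iff_…`, `s_N16HolderMS_rRec₁₃CoPH(On)_iff_ofRecord`; through them dag-n22-e's (T-RATE) layer-B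
`CoPH` master faces) and module 32 `…N16LeafSlotAllTorus` (the AT-keyed slots and their one-application closers `n16At_of_inEndRegime_leafSlotAT`,
`n16HolderAt_of_inEndRegimeH_leafSlotHolderAT`, `n16HolderMSAt_of_inEndRegimeHMS_leafSlotHolderMSAT`).  Restates nothing; every statement is the univ-keyed original with
`LeafSlot ↦ LeafSlotAT` (`LeafSlotHolder β ↦ LeafSlotHolderAT β`, `LeafSlotHolderMS β ↦ LeafSlotHolderMSAT β`) and every other binder VERBATIM; proofs = the originals' with module 32's closer.

WHY (LOCATED-4∕5 of this seat ∕ dag-n16-c F49–F50 ∕ ref-H V-256 ∕ HOME `HANDOFF.md` §g10 (D1)).  The univ-keyed `LeafSlot c` asks node N05's `B8.Thm4Body c₁ B₁′` on the law-free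
univ sub-family `{i : ZdIdx 4 c.L // i.Ω 0 = univ}` of `zdGF3 (M_N ℂ) c.L 1 len` — REFUTED by dag-n16-c's `not_thm4Printed_zdGF3_univ` whenever `0 < c₁` and vacuous at `c₁ = c₁′ = 0`;
so every composer binder `h16 : ∀ F, (guard) → InEndRegime (…) ∧ LeafSlot (…)` (dag-n27-c XLIᶜᵒᵖᴴ §3 p551502 :90∕:133∕:192∕:251, XLᶜᵒᵖᴴ, K3⁷ Homes `_of_leafSlot`) is VACUOUS-OR-
UNSATISFIABLE as stated in its leaf conjunct.  The AT-keyed slot asks the same conjuncts on the PINNED all-torus proper members only (canonical non-empty bonds, inside n05-c's record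
sub-index `IdxB8SubB` by F47 §1 `idxB8LawsB_allTorusPinned`) — the LIVE currency of modules 33–38ᴴ.  With THIS file a composer repairs its N16 slot by ONE token at the call site
(`s_N16_rRec₁₃CoPHOn_ofRecord_of_leafSlot ↦ …_of_leafSlotAT`, `h16`'s `LeafSlot ↦ LeafSlotAT`), and the repaired `h16` is exactly what modules 37ᴴ ∕ 38ᴴ
(`exists_letters_s_N16_readingOfRecord₁₃CoPHOn_of_edges_allTorus` ∕ `…_of_sockets_allTorus`, last two conjuncts) deliver per family.

HONEST FRAMING.  Kernel bookkeeping by name (one application of an iff and a closer per theorem); no estimate; `InEndRegime…` ∕ `LeafSlot…AT` are HYPOTHESES asserted for no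
family; no admissible Stage-13 tuple of this edition is claimed to exist (K0⁷ OPEN); nothing of Bałaban's asserted; **N16 ∕ NE3 is NOT discharged**; count-neutral (typed 28∕28 ·
discharged 5∕27, A 5∕28 UNMOVED); one finite four-torus at fixed ε — NOT ℝ⁴, NOT infinite volume, NOT OS, NOT a mass gap, NOT Clay.
-/

set_option autoImplicit false

namespace Summit.QuantumFields.YangMills.BalabanUVNodes.N16AtRRec13CoPHLeafSlotAT

open Literature.MathematicalPhysics.QuantumFieldTheory.Balaban1983to89
open Literature.MathematicalPhysics.QuantumFieldTheory.Balaban1983to89.T4Continuum (T4Family ULoop)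
open Node00 (IsDatumOfRecord₁₃CCoPH Stage13HParams NE3Objects₁₁ NE3Letters₁₁ NE2Objects₁₁ ne3ConstLayerOfRecord₁₁ ne3NperOfRecord₁₁ MatA)
open Node00.W1 (ReadingData)
open Summit.QuantumFields.BalabanUV.T4Continuum
open YMDAG.UVSplit (Datum NE3Carriers NE1pCarriers S_N16 ne3OfRecord₁₁ RateReading₁₃CoPH RRec₁₃CoPH RRec₁₃CoPHOn readingOfRecord₁₃CoPH readingOfRecord₁₃CoPH_ne3
  s_N16_rRec₁₃CoPHOn_iff)
open Summit.QuantumFields.YangMills.BalabanUVNodes.N16Regime (InEndRegime radiusOfRecord constOfRecord)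
open Summit.QuantumFields.YangMills.BalabanUVNodes.N16HolderDefs (S_N16Holder)
open Summit.QuantumFields.YangMills.BalabanUVNodes.N16HolderMSDefs (S_N16HolderMS)
open Summit.QuantumFields.YangMills.BalabanUVNodes.N16HolderRegime (InEndRegimeH)
open Summit.QuantumFields.YangMills.BalabanUVNodes.N16HolderMSRegime (InEndRegimeHMS)
open Summit.QuantumFields.YangMills.BalabanUVNodes.N16AtRRec13CoPH (s_N16_rRec₁₃CoPH_iff_of_constLayer s_N16_rRec₁₃CoPHOn_of_constLayer)
open Summit.QuantumFields.YangMills.BalabanUVNodes.N16AtRRec13CoPHLines (s_N16Holder_rRec₁₃CoPHOn_iff_ofRecord s_N16Holder_rRec₁₃CoPH_iff_of_constLayer)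
open Summit.QuantumFields.YangMills.BalabanUVNodes.N16HolderMSAtRecord13CoPH (s_N16HolderMS_rRec₁₃CoPHOn_iff_ofRecord s_N16HolderMS_rRec₁₃CoPH_iff_ofRecord)
open Summit.QuantumFields.YangMills.BalabanUVNodes.N16AtRRec12OfRecord (inEndRegime_ofRecord_of_letters)
open Summit.QuantumFields.YangMills.BalabanUVNodes.N16LeafSlotAllTorus (LeafSlotAT LeafSlotHolderAT LeafSlotHolderMSAT n16At_of_inEndRegime_leafSlotAT
  n16HolderAt_of_inEndRegimeH_leafSlotHolderAT n16HolderMSAt_of_inEndRegimeHMS_leafSlotHolderMSAT)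

noncomputable section

variable {N : ℕ} [NeZero N] (𝔯 : RateReading₁₃CoPH N) (Rg : (F : T4Family) → Stage13HParams F N → Prop)

/-! ## §1 β = 1 at a layer-B `CoPH` reading `𝔯` (twins of module 19ᴴ l.132 ∕ 221 ∕ 256 ∕ 298 ∕ 312 with `LeafSlot ↦ LeafSlotAT`) -/

/-- **THE KNIT AT THE REGIME-RESTRICTED STAGE-13 HOME, AT-KEYED LEAF FORM**: `InEndRegime ∧ LeafSlotAT` at the reading's NE3 bundle of every guarded admissible tuple with
provisos, every `(g₀, os)` and run length ⇒ `S_N16 (RRec₁₃CoPHOn 𝔯 Rg)` (dag-n22-e's master face `s_N16_rRec₁₃CoPHOn_iff` closed by module 32's `n16At_of_inEndRegime_leafSlotAT`;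
module 19ᴴ l.132 with `LeafSlot ↦ LeafSlotAT`).  Neither hypothesis is asserted here. [folklore] -/
theorem s_N16_rRec₁₃CoPHOn_of_inEndRegime_leafSlotAT
    (h : ∀ (F : T4Family) (θ : Stage13HParams F N) (hP : θ.Provisos₁₃CoPH F N), Rg F θ → θ.Admissible F N →
      ∀ (g₀ : ℕ → ℝ) (os : List (ULoop F)) (k : ℕ),
        InEndRegime (ne3OfRecord₁₁ F ((𝔯.lit F θ hP g₀ os).ne3 k)) ∧ LeafSlotAT (ne3OfRecord₁₁ F ((𝔯.lit F θ hP g₀ os).ne3 k))) :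
    S_N16 (RRec₁₃CoPHOn 𝔯 Rg) :=
  (s_N16_rRec₁₃CoPHOn_iff 𝔯 Rg).2 fun F θ hP hRg hθ g₀ os k =>
    n16At_of_inEndRegime_leafSlotAT (h F θ hP hRg hθ g₀ os k).1 (h F θ hP hRg hθ g₀ os k).2

section ConstLayer

variable (o : T4Family → NE3Objects₁₁ N)

/-- **THE KNIT AT A CONSTANT LAYER, CANONICAL HOME, AT-KEYED LEAF FORM**: `InEndRegime ∧ LeafSlotAT` at the ONE bundle `ne3OfRecord₁₁ F (o F)` of every family carrying a
Stage-13 datum of record ⇒ `S_N16 (RRec₁₃CoPH 𝔯)` (module 19ᴴ l.221 with `LeafSlot ↦ LeafSlotAT`). [folklore] -/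
theorem s_N16_rRec₁₃CoPH_of_constLayer_leafSlotAT
    (hconst : ∀ (F : T4Family) (θ : Stage13HParams F N) (hP : θ.Provisos₁₃CoPH F N) (g₀ : ℕ → ℝ) (os : List (ULoop F)) (k : ℕ), (𝔯.lit F θ hP g₀ os).ne3 k = o F)
    (h : ∀ (F : T4Family), (∃ D : Datum F N, IsDatumOfRecord₁₃CCoPH F N D) → InEndRegime (ne3OfRecord₁₁ F (o F)) ∧ LeafSlotAT (ne3OfRecord₁₁ F (o F))) :
    S_N16 (RRec₁₃CoPH 𝔯) :=
  (s_N16_rRec₁₃CoPH_iff_of_constLayer 𝔯 o hconst).2 fun F hF => n16At_of_inEndRegime_leafSlotAT (h F hF).1 (h F hF).2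

/-- **THE KNIT AT A CONSTANT LAYER, REGIME-RESTRICTED, AT-KEYED LEAF FORM** (module 19ᴴ l.256 with `LeafSlot ↦ LeafSlotAT`). [folklore] -/
theorem s_N16_rRec₁₃CoPHOn_of_constLayer_leafSlotAT
    (hconst : ∀ (F : T4Family) (θ : Stage13HParams F N) (hP : θ.Provisos₁₃CoPH F N) (g₀ : ℕ → ℝ) (os : List (ULoop F)) (k : ℕ), (𝔯.lit F θ hP g₀ os).ne3 k = o F)
    (h : ∀ (F : T4Family), (∃ θ : Stage13HParams F N, θ.Provisos₁₃CoPH F N ∧ Rg F θ ∧ θ.Admissible F N) →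
      InEndRegime (ne3OfRecord₁₁ F (o F)) ∧ LeafSlotAT (ne3OfRecord₁₁ F (o F))) :
    S_N16 (RRec₁₃CoPHOn 𝔯 Rg) :=
  s_N16_rRec₁₃CoPHOn_of_constLayer 𝔯 Rg o hconst fun F hF => n16At_of_inEndRegime_leafSlotAT (h F hF).1 (h F hF).2

end ConstLayer

section OfRecord

variable (ℓ : T4Family → NE3Letters₁₁)

/-- **THE KNIT AT THE OBJECT OF RECORD, REGIME-RESTRICTED, AT-KEYED LEAF FORM**: for a reading pinned at RR-1's constant layer `ne3ConstLayerOfRecord₁₁ F N (ℓ F)`,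
`InEndRegime ∧ LeafSlotAT` at the one bundle of every guarded family ⇒ the stub (module 19ᴴ l.298 with `LeafSlot ↦ LeafSlotAT`; dag-n27-c's `_of_leafSlot` call sites take this
name with the repaired `h16`). [folklore] -/
theorem s_N16_rRec₁₃CoPHOn_ofRecord_of_leafSlotAT
    (hpin : ∀ (F : T4Family) (θ : Stage13HParams F N) (hP : θ.Provisos₁₃CoPH F N) (g₀ : ℕ → ℝ) (os : List (ULoop F)) (k : ℕ),
      (𝔯.lit F θ hP g₀ os).ne3 k = ne3ConstLayerOfRecord₁₁ F N (ℓ F))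
    (h : ∀ (F : T4Family), (∃ θ : Stage13HParams F N, θ.Provisos₁₃CoPH F N ∧ Rg F θ ∧ θ.Admissible F N) →
      InEndRegime (ne3OfRecord₁₁ F (ne3ConstLayerOfRecord₁₁ F N (ℓ F))) ∧ LeafSlotAT (ne3OfRecord₁₁ F (ne3ConstLayerOfRecord₁₁ F N (ℓ F)))) :
    S_N16 (RRec₁₃CoPHOn 𝔯 Rg) :=
  s_N16_rRec₁₃CoPHOn_of_constLayer_leafSlotAT 𝔯 Rg _ hpin h

/-- **THE SAME AT THE CANONICAL HOME** (content once per family carrying a Stage-13 datum of record). [folklore] -/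
theorem s_N16_rRec₁₃CoPH_ofRecord_of_leafSlotAT
    (hpin : ∀ (F : T4Family) (θ : Stage13HParams F N) (hP : θ.Provisos₁₃CoPH F N) (g₀ : ℕ → ℝ) (os : List (ULoop F)) (k : ℕ),
      (𝔯.lit F θ hP g₀ os).ne3 k = ne3ConstLayerOfRecord₁₁ F N (ℓ F))
    (h : ∀ (F : T4Family), (∃ D : Datum F N, IsDatumOfRecord₁₃CCoPH F N D) →
      InEndRegime (ne3OfRecord₁₁ F (ne3ConstLayerOfRecord₁₁ F N (ℓ F))) ∧ LeafSlotAT (ne3OfRecord₁₁ F (ne3ConstLayerOfRecord₁₁ F N (ℓ F)))) :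
    S_N16 (RRec₁₃CoPH 𝔯) :=
  s_N16_rRec₁₃CoPH_of_constLayer_leafSlotAT 𝔯 _ hpin h

/-- **THE KNIT AT THE OBJECT OF RECORD WITH LETTERS TUNED INSIDE THE TOLERANCE, REGIME-RESTRICTED — `LeafSlotAT` ALONE**: letters `⟨r, b F, g F, C F, r, Λ₂′ F⟩` with
`r = radiusOfRecord N F.L (ne3NperOfRecord₁₁ F 0 0)`, `0 < g F`, `0 ≤ b F ≤ r∕2`, `constOfRecord … (g F) ≤ C F` make the proviso automatic (file 11 v1.1's
`inEndRegime_ofRecord_of_letters`); `LeafSlotAT` at the one bundle of every guarded family then gives the stub (module 19ᴴ l.312 with `LeafSlot ↦ LeafSlotAT`). [folklore] -/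
theorem s_N16_rRec₁₃CoPHOn_ofRecord_of_letters_of_leafSlotAT (g b C Λ₂' : T4Family → ℝ) (hg : ∀ F, 0 < g F) (hb₀ : ∀ F, 0 ≤ b F)
    (hb : ∀ F : T4Family, b F ≤ radiusOfRecord N F.L (ne3NperOfRecord₁₁ F 0 0) / 2)
    (hC : ∀ F : T4Family, constOfRecord N F.L (ne3NperOfRecord₁₁ F 0 0) (g F) ≤ C F)
    (hpin : ∀ (F : T4Family) (θ : Stage13HParams F N) (hP : θ.Provisos₁₃CoPH F N) (g₀ : ℕ → ℝ) (os : List (ULoop F)) (k : ℕ),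
      (𝔯.lit F θ hP g₀ os).ne3 k = ne3ConstLayerOfRecord₁₁ F N
        ⟨radiusOfRecord N F.L (ne3NperOfRecord₁₁ F 0 0), b F, g F, C F, radiusOfRecord N F.L (ne3NperOfRecord₁₁ F 0 0), Λ₂' F⟩)
    (hslot : ∀ (F : T4Family), (∃ θ : Stage13HParams F N, θ.Provisos₁₃CoPH F N ∧ Rg F θ ∧ θ.Admissible F N) →
      LeafSlotAT (ne3OfRecord₁₁ F (ne3ConstLayerOfRecord₁₁ F N
        ⟨radiusOfRecord N F.L (ne3NperOfRecord₁₁ F 0 0), b F, g F, C F, radiusOfRecord N F.L (ne3NperOfRecord₁₁ F 0 0), Λ₂' F⟩))) :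
    S_N16 (RRec₁₃CoPHOn 𝔯 Rg) :=
  s_N16_rRec₁₃CoPHOn_of_constLayer_leafSlotAT 𝔯 Rg _ hpin fun F hF =>
    ⟨inEndRegime_ofRecord_of_letters F (hg F) (hb₀ F) (hb F) (hC F) (Λ₂' F), hslot F hF⟩

/-! ## §2 R-β and R-β″ at the object of record (twins of modules 20ᴴ ∕ 22ᴴ's leaf-form knits with `LeafSlotHolder ↦ LeafSlotHolderAT`, `LeafSlotHolderMS ↦ LeafSlotHolderMSAT`) -/

/-- **`S_N16Holder β (RRec₁₃CoPHOn 𝔯 Rg)` FROM THE β-UNIFORM PROVISO AND THE AT-KEYED LEAF β-SLOT at the one bundle of every guarded family** (`0 ≤ β ≤ 1`; module 20ᴴ's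
`s_N16Holder_rRec₁₃CoPHOn_iff_ofRecord` closed by module 32's `n16HolderAt_of_inEndRegimeH_leafSlotHolderAT`). [folklore] -/
theorem s_N16Holder_rRec₁₃CoPHOn_ofRecord_of_leafSlotHolderAT {β : ℝ} (hβ0 : 0 ≤ β) (hβ1 : β ≤ 1)
    (hpin : ∀ (F : T4Family) (θ : Stage13HParams F N) (hP : θ.Provisos₁₃CoPH F N) (g₀ : ℕ → ℝ) (os : List (ULoop F)) (k : ℕ),
      (𝔯.lit F θ hP g₀ os).ne3 k = ne3ConstLayerOfRecord₁₁ F N (ℓ F))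
    (h : ∀ (F : T4Family), (∃ θ : Stage13HParams F N, θ.Provisos₁₃CoPH F N ∧ Rg F θ ∧ θ.Admissible F N) →
      InEndRegimeH (ne3OfRecord₁₁ F (ne3ConstLayerOfRecord₁₁ F N (ℓ F))) ∧ LeafSlotHolderAT (ne3OfRecord₁₁ F (ne3ConstLayerOfRecord₁₁ F N (ℓ F))) β) :
    S_N16Holder β (RRec₁₃CoPHOn 𝔯 Rg) :=
  (s_N16Holder_rRec₁₃CoPHOn_iff_ofRecord β 𝔯 Rg ℓ hpin).2 fun F hF => n16HolderAt_of_inEndRegimeH_leafSlotHolderAT (h F hF).1 hβ0 hβ1 (h F hF).2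

/-- **The same at the canonical home** (`S_N16Holder β (RRec₁₃CoPH 𝔯)`, content once per family carrying a Stage-13 datum of record). [folklore] -/
theorem s_N16Holder_rRec₁₃CoPH_ofRecord_of_leafSlotHolderAT {β : ℝ} (hβ0 : 0 ≤ β) (hβ1 : β ≤ 1)
    (hpin : ∀ (F : T4Family) (θ : Stage13HParams F N) (hP : θ.Provisos₁₃CoPH F N) (g₀ : ℕ → ℝ) (os : List (ULoop F)) (k : ℕ),
      (𝔯.lit F θ hP g₀ os).ne3 k = ne3ConstLayerOfRecord₁₁ F N (ℓ F))
    (h : ∀ (F : T4Family), (∃ D : Datum F N, IsDatumOfRecord₁₃CCoPH F N D) →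
      InEndRegimeH (ne3OfRecord₁₁ F (ne3ConstLayerOfRecord₁₁ F N (ℓ F))) ∧ LeafSlotHolderAT (ne3OfRecord₁₁ F (ne3ConstLayerOfRecord₁₁ F N (ℓ F))) β) :
    S_N16Holder β (RRec₁₃CoPH 𝔯) :=
  (s_N16Holder_rRec₁₃CoPH_iff_of_constLayer β 𝔯 (fun F => ne3ConstLayerOfRecord₁₁ F N (ℓ F)) hpin).2 fun F hF =>
    n16HolderAt_of_inEndRegimeH_leafSlotHolderAT (h F hF).1 hβ0 hβ1 (h F hF).2

/-- **`S_N16HolderMS β (RRec₁₃CoPHOn 𝔯 Rg)` FROM THE MS PROVISO AND THE AT-KEYED MS LEAF β-SLOT at the one bundle of every guarded family** (`0 ≤ β ≤ 1`; module 22ᴴ's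
`s_N16HolderMS_rRec₁₃CoPHOn_iff_ofRecord` closed by module 32's `n16HolderMSAt_of_inEndRegimeHMS_leafSlotHolderMSAT`). [folklore] -/
theorem s_N16HolderMS_rRec₁₃CoPHOn_ofRecord_of_leafSlotHolderMSAT {β : ℝ} (hβ0 : 0 ≤ β) (hβ1 : β ≤ 1)
    (hpin : ∀ (F : T4Family) (θ : Stage13HParams F N) (hP : θ.Provisos₁₃CoPH F N) (g₀ : ℕ → ℝ) (os : List (ULoop F)) (k : ℕ),
      (𝔯.lit F θ hP g₀ os).ne3 k = ne3ConstLayerOfRecord₁₁ F N (ℓ F))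
    (h : ∀ (F : T4Family), (∃ θ : Stage13HParams F N, θ.Provisos₁₃CoPH F N ∧ Rg F θ ∧ θ.Admissible F N) →
      InEndRegimeHMS (ne3OfRecord₁₁ F (ne3ConstLayerOfRecord₁₁ F N (ℓ F))) ∧ LeafSlotHolderMSAT (ne3OfRecord₁₁ F (ne3ConstLayerOfRecord₁₁ F N (ℓ F))) β) :
    S_N16HolderMS β (RRec₁₃CoPHOn 𝔯 Rg) :=
  (s_N16HolderMS_rRec₁₃CoPHOn_iff_ofRecord β 𝔯 Rg ℓ hpin).2 fun F hF => n16HolderMSAt_of_inEndRegimeHMS_leafSlotHolderMSAT (h F hF).1 hβ0 hβ1 (h F hF).2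

/-- **The same at the canonical home** (`S_N16HolderMS β (RRec₁₃CoPH 𝔯)`). [folklore] -/
theorem s_N16HolderMS_rRec₁₃CoPH_ofRecord_of_leafSlotHolderMSAT {β : ℝ} (hβ0 : 0 ≤ β) (hβ1 : β ≤ 1)
    (hpin : ∀ (F : T4Family) (θ : Stage13HParams F N) (hP : θ.Provisos₁₃CoPH F N) (g₀ : ℕ → ℝ) (os : List (ULoop F)) (k : ℕ),
      (𝔯.lit F θ hP g₀ os).ne3 k = ne3ConstLayerOfRecord₁₁ F N (ℓ F))
    (h : ∀ (F : T4Family), (∃ D : Datum F N, IsDatumOfRecord₁₃CCoPH F N D) →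
      InEndRegimeHMS (ne3OfRecord₁₁ F (ne3ConstLayerOfRecord₁₁ F N (ℓ F))) ∧ LeafSlotHolderMSAT (ne3OfRecord₁₁ F (ne3ConstLayerOfRecord₁₁ F N (ℓ F))) β) :
    S_N16HolderMS β (RRec₁₃CoPH 𝔯) :=
  (s_N16HolderMS_rRec₁₃CoPH_iff_ofRecord β 𝔯 ℓ hpin).2 fun F hF => n16HolderMSAt_of_inEndRegimeHMS_leafSlotHolderMSAT (h F hF).1 hβ0 hβ1 (h F hF).2

end OfRecord

/-! ## §3 At dag-n22-e's NAMED reading of record `readingOfRecord₁₃CoPH w1 ℓ₃ ne2 ne1` (`hpin := readingOfRecord₁₃CoPH_ne3`; twins of module 23ᴴ l.126 ∕ 133 ∕ 163) -/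

section Reading

variable (w1 : (F : T4Family) → (θ : Stage13HParams F N) → ReadingData F (MatA N) θ.τ9.M) (ℓ₃ : T4Family → NE3Letters₁₁)
  (ne2 : (F : T4Family) → Stage13HParams F N → (ℕ → ℝ) → List (ULoop F) → ℕ → NE2Objects₁₁)
  (ne1 : (F : T4Family) → Stage13HParams F N → (ℕ → ℝ) → List (ULoop F) → NE1pCarriers)

/-- ★ **THE KNIT AT THE REGIME-RESTRICTED READING OF RECORD, AT-KEYED LEAF FORM** — dag-n27-c's K3⁷ binder `h16 : ∀ F, (∃ θ, θ.Provisos₁₃CoPH F N ∧ Rg F θ ∧ θ.Admissible F N) →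
InEndRegime (…) ∧ LeafSlotAT (…)` (the LIVE currency; exactly the last two conjuncts modules 37ᴴ ∕ 38ᴴ deliver per family) gives `S_N16 (RRec₁₃CoPHOn (readingOfRecord₁₃CoPH w1 ℓ₃ ne2 ne1) Rg)`
(module 23ᴴ l.126 with `LeafSlot ↦ LeafSlotAT`). [folklore] -/
theorem s_N16_readingOfRecord₁₃CoPHOn_of_leafSlotAT
    (h : ∀ (F : T4Family), (∃ θ : Stage13HParams F N, θ.Provisos₁₃CoPH F N ∧ Rg F θ ∧ θ.Admissible F N) →
      InEndRegime (ne3OfRecord₁₁ F (ne3ConstLayerOfRecord₁₁ F N (ℓ₃ F))) ∧ LeafSlotAT (ne3OfRecord₁₁ F (ne3ConstLayerOfRecord₁₁ F N (ℓ₃ F)))) :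
    S_N16 (RRec₁₃CoPHOn (readingOfRecord₁₃CoPH w1 ℓ₃ ne2 ne1) Rg) :=
  s_N16_rRec₁₃CoPHOn_ofRecord_of_leafSlotAT _ Rg ℓ₃ (readingOfRecord₁₃CoPH_ne3 w1 ℓ₃ ne2 ne1) h

/-- **THE KNIT AT THE CANONICAL READING OF RECORD, AT-KEYED LEAF FORM** (dag-n21-d's ∕ dag-n27-c's canonical `h16`; module 23ᴴ l.133 with `LeafSlot ↦ LeafSlotAT`). [folklore] -/
theorem s_N16_readingOfRecord₁₃CoPH_of_leafSlotAT
    (h : ∀ (F : T4Family), (∃ D : Datum F N, IsDatumOfRecord₁₃CCoPH F N D) →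
      InEndRegime (ne3OfRecord₁₁ F (ne3ConstLayerOfRecord₁₁ F N (ℓ₃ F))) ∧ LeafSlotAT (ne3OfRecord₁₁ F (ne3ConstLayerOfRecord₁₁ F N (ℓ₃ F)))) :
    S_N16 (RRec₁₃CoPH (readingOfRecord₁₃CoPH w1 ℓ₃ ne2 ne1)) :=
  s_N16_rRec₁₃CoPH_of_constLayer_leafSlotAT _ (fun F => ne3ConstLayerOfRecord₁₁ F N (ℓ₃ F)) (readingOfRecord₁₃CoPH_ne3 w1 ℓ₃ ne2 ne1) h

/-- **`S_N16Holder β` AT THE REGIME-RESTRICTED READING OF RECORD FROM THE β-UNIFORM PROVISO AND THE AT-KEYED LEAF β-SLOT** (`0 ≤ β ≤ 1`; module 23ᴴ l.163 with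
`LeafSlotHolder ↦ LeafSlotHolderAT`). [folklore] -/
theorem s_N16Holder_readingOfRecord₁₃CoPHOn_of_leafSlotHolderAT {β : ℝ} (hβ0 : 0 ≤ β) (hβ1 : β ≤ 1)
    (h : ∀ (F : T4Family), (∃ θ : Stage13HParams F N, θ.Provisos₁₃CoPH F N ∧ Rg F θ ∧ θ.Admissible F N) →
      InEndRegimeH (ne3OfRecord₁₁ F (ne3ConstLayerOfRecord₁₁ F N (ℓ₃ F))) ∧ LeafSlotHolderAT (ne3OfRecord₁₁ F (ne3ConstLayerOfRecord₁₁ F N (ℓ₃ F))) β) :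
    S_N16Holder β (RRec₁₃CoPHOn (readingOfRecord₁₃CoPH w1 ℓ₃ ne2 ne1) Rg) :=
  s_N16Holder_rRec₁₃CoPHOn_ofRecord_of_leafSlotHolderAT _ Rg ℓ₃ hβ0 hβ1 (readingOfRecord₁₃CoPH_ne3 w1 ℓ₃ ne2 ne1) h

/-- **`S_N16HolderMS β` AT THE REGIME-RESTRICTED READING OF RECORD FROM THE MS PROVISO AND THE AT-KEYED MS LEAF β-SLOT** (`0 ≤ β ≤ 1`). [folklore] -/
theorem s_N16HolderMS_readingOfRecord₁₃CoPHOn_of_leafSlotHolderMSAT {β : ℝ} (hβ0 : 0 ≤ β) (hβ1 : β ≤ 1)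
    (h : ∀ (F : T4Family), (∃ θ : Stage13HParams F N, θ.Provisos₁₃CoPH F N ∧ Rg F θ ∧ θ.Admissible F N) →
      InEndRegimeHMS (ne3OfRecord₁₁ F (ne3ConstLayerOfRecord₁₁ F N (ℓ₃ F))) ∧ LeafSlotHolderMSAT (ne3OfRecord₁₁ F (ne3ConstLayerOfRecord₁₁ F N (ℓ₃ F))) β) :
    S_N16HolderMS β (RRec₁₃CoPHOn (readingOfRecord₁₃CoPH w1 ℓ₃ ne2 ne1) Rg) :=
  s_N16HolderMS_rRec₁₃CoPHOn_ofRecord_of_leafSlotHolderMSAT _ Rg ℓ₃ hβ0 hβ1 (readingOfRecord₁₃CoPH_ne3 w1 ℓ₃ ne2 ne1) h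

end Reading

end

end Summit.QuantumFields.YangMills.BalabanUVNodes.N16AtRRec13CoPHLeafSlotAT
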